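import Mathlib
import Literature.AlgebraicGeometry.Resolution.LocalBlowup
import Literature.AlgebraicGeometry.Resolution.QuadraticTransforms
import Summits.ResolutionOfSingularities.ResolutionOfSingularities.Theorems.FrobeniusClosingSteerSteeredMembersRegular

/-!
# Crux `Steer` (stmt-ResolutionOfSingularities-16345), σ-residual LOW half at `p = 2`:
# the chart of a local blowing up along an ideal and the `δ`-span lemma (support for `lowOrder_step_two`)

OURS (campaign `res-hironaka`, rung L ★L-G4, slot W4.1, chain W4.1; seat `res-D-pv-028` g6, res-L0-w41-plan-1 RULING 15
(15b); replaces the role of no printed item; NOT a statement of the manuscript under review [claim: Hironaka2017,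
status: under-review]; AI review is weaker than expert review). The positive-dimensional-centre analogue of
res-L0-w41-stub-3's `RankFourExit.span_delta_eq_top` (point blow-ups, p-id of `…SteerRankFourExitSpan`):

* §1 `eq_locAtCentre_closure_div` — a local blowing up `R₁` of `R` along `P` with respect to `O` (NSp Def. 2.11,
  `IsLocalBlowupAlong`) is `(R[P/x])_{𝔪_O}` for EVERY exceptional parameter `x` (non-zero element of `P` of maximal
  `O`-value), not only for the generator `u₀` of the definition (`SteeredMembersRegular.locAtCentre_closure_div_eq`);
  hence `y / x ∈ R₁` for `y ∈ P` (`div_mem_of_isLocalBlowupAlong`);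
* §2 `span_delta_eq_top` — characteristic `2`: for an additive map `δ : R₁ → 𝔫/𝔫²` with Leibniz rule, killing
  squares and equal to the projection on `𝔫` (the cotangent derivation of `CotangentDerivation.exists_cotangentDerivation`),
  and generators `u` of `P`, the classes `δ(a)` (`a ∈ R`) and `δ(u_j / x)` SPAN `𝔫/𝔫²` (closure induction over
  `R[P/x]`, fractions with unit denominators);
* §3 `delta_old_mem_span` — `δ` of an OLD element `a ∈ R` lies in the span of `δ x` and the `δ w_l` for any family
  `w` with `𝔪_R = (u, w)` (residues of `R` are squares: `a = b² + m`, `m = Σ r_j u_j + Σ s_l w_l`, `u_j = x · (u_j/x)`).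
[cite: NovacoskiSpivakovsky2014, Def. 2.11] [folklore]
-/

-- The namespace mirrors the chain's helper layout (`…Theorems.SwitchingDichotomy.<Piece>`) on purpose.
set_option linter.dupNamespace false

noncomputable section

namespace Summit.ResolutionOfSingularities.ResolutionOfSingularities.Theorems.SwitchingDichotomy.LowOrderChart

open IsLocalRing Module Literature.AlgebraicGeometry.Resolution
open Summit.ResolutionOfSingularities.ResolutionOfSingularities.Theorems.SwitchingDichotomy

universe u

variable {K : Type u} [Field K]

/-! ## §1 The chart of a local blowing up along `P` at any exceptional parameter -/

/-- **The local blowing up along `P` is `(R[P/x])_{𝔪_O}` for every exceptional parameter `x`** (a non-zero element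
of `P` of maximal `O`-value): the defining generator `u₀` and `x` have the same value, so the two charts have the
same local ring at the centre of `O`. [cite: NovacoskiSpivakovsky2014, Def. 2.11] -/
theorem eq_locAtCentre_closure_div {O : ValuationSubring K} {R R₁ : Subring K} {P : Ideal R}
    (H : IsLocalBlowupAlong O R P R₁) {x : K} (hxR : x ∈ R) (hxP : (⟨x, hxR⟩ : R) ∈ P) (hx0 : x ≠ 0)
    (hmax : ∀ y : R, y ∈ P → O.valuation (y : K) ≤ O.valuation x) :
    R₁ = locAtCentre (Subring.closure ((R : Set K) ∪ (fun y : R => (y : K) / x) '' (P : Set R))) O := by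
  obtain ⟨hRO, u, u₀, hspan, hu₀, hu₀0, hval, hR₁⟩ := H
  have hu₀P : u₀ ∈ P := by
    rw [← hspan]
    exact Ideal.subset_span hu₀
  have hu₀K : ((u₀ : R) : K) ≠ 0 := fun e => hu₀0 (Subtype.ext e)
  -- `v(u₀) = v(x)`
  have hxspan : (⟨x, hxR⟩ : R) ∈ Ideal.span (u : Set R) := by
    rw [hspan]
    exact hxP
  have hle : O.valuation ((⟨x, hxR⟩ : R) : K) ≤ O.valuation ((u₀ : R) : K) :=
    SteeredMembersRegular.valuation_le_of_mem_span hRO hval hxspan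
  have hge : O.valuation ((u₀ : R) : K) ≤ O.valuation x := hmax u₀ hu₀P
  have heq : O.valuation ((u₀ : R) : K) = O.valuation ((⟨x, hxR⟩ : R) : K) := le_antisymm hge hle
  have h1 := SteeredMembersRegular.closure_div_eq_of_span_eq R ((u₀ : R) : K) (u : Set R) hspan
  have h2 := SteeredMembersRegular.locAtCentre_closure_div_eq (O := O) hu₀P hxP hu₀K hx0 heq
  rw [hR₁, h1]
  exact h2

/-- Along a local blowing up along `P`, `y / x ∈ R₁` for every `y ∈ P` and every exceptional parameter `x`.
[cite: NovacoskiSpivakovsky2014, Def. 2.11] -/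
theorem div_mem_of_isLocalBlowupAlong {O : ValuationSubring K} {R R₁ : Subring K} {P : Ideal R}
    (H : IsLocalBlowupAlong O R P R₁) {x : K} (hxR : x ∈ R) (hxP : (⟨x, hxR⟩ : R) ∈ P) (hx0 : x ≠ 0)
    (hmax : ∀ y : R, y ∈ P → O.valuation (y : K) ≤ O.valuation x) {y : R} (hy : y ∈ P) :
    (y : K) / x ∈ R₁ := by
  rw [eq_locAtCentre_closure_div H hxR hxP hx0 hmax]
  exact le_locAtCentre _ O (SteeredMembersRegular.div_mem_closure_div x hy)

/-! ## §2 The `δ`-span lemma along a local blowing up -/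

section Span

variable [CharP K 2] {O : ValuationSubring K} {R R₁ : Subring K} [IsLocalRing R₁] {P : Ideal R}
  {x : K}
  (hR₁ : R₁ = locAtCentre (Subring.closure ((R : Set K) ∪ (fun y : R => (y : K) / x) '' (P : Set R))) O)
  (hRR₁ : R ≤ R₁)
  {h : ℕ} (u : Fin h → R) (hu : Ideal.span (Set.range u) = P)
  (v : Fin h → R₁) (hv : ∀ j, (v j : K) = (u j : K) / x)
  (δ : R₁ → CotangentSpace R₁)
  (hδadd : ∀ a b : R₁, δ (a + b) = δ a + δ b)
  (hδmul : ∀ a b : R₁, δ (a * b) = residue R₁ a • δ b + residue R₁ b • δ a)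
  (hδmem : ∀ (m : R₁) (hm : m ∈ maximalIdeal R₁), δ m = (maximalIdeal R₁).toCotangent ⟨m, hm⟩)
  (hδsq : ∀ b : R₁, δ (b ^ 2) = 0)
include hR₁ hu hv hδadd hδmul hδmem hδsq

/-- **The `δ`-classes of the old elements and of the quotients `u_j / x` span the cotangent space of the local
blowing up** `R₁ = (R[P/x])_{𝔪_O}`, `P = (u_j)_j`: every element of `R₁` is a fraction of polynomials in the `u_j/x`
with coefficients in `R` and a unit denominator; Leibniz handles sums, products and unit inverses, and `δ`
restricted to `𝔫` is onto `𝔫/𝔫²`. [folklore] -/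
theorem span_delta_eq_top :
    Submodule.span (ResidueField R₁)
      (Set.range (fun a : R => δ ⟨a, hRR₁ a.2⟩) ∪ Set.range (fun j => δ (v j))) = ⊤ := by
  classical
  set S : Submodule (ResidueField R₁) (CotangentSpace R₁) :=
    Submodule.span (ResidueField R₁)
      (Set.range (fun a : R => δ ⟨a, hRR₁ a.2⟩) ∪ Set.range (fun j => δ (v j))) with hS
  have hold : ∀ (a : K) (ha : a ∈ R), δ ⟨a, hRR₁ ha⟩ ∈ S := fun a ha =>
    Submodule.subset_span (Or.inl ⟨⟨a, ha⟩, rfl⟩)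
  have hvS : ∀ j, δ (v j) ∈ S := fun j => Submodule.subset_span (Or.inr ⟨j, rfl⟩)
  have hδ0 : δ 0 = 0 := by simpa using hδsq 0
  have hδ1 : δ 1 = 0 := by simpa using hδsq 1
  set B : Subring K := Subring.closure ((R : Set K) ∪ (fun y : R => (y : K) / x) '' (P : Set R)) with hB
  have hBR₁ : B ≤ R₁ := by rw [hR₁]; exact le_locAtCentre _ O
  -- (a) the quotients `y / x`, `y ∈ P`: `y / x = Σ r_j (u_j / x)`
  have hquot : ∀ (y : R), y ∈ P → ∀ hy₁ : (y : K) / x ∈ R₁, δ ⟨(y : K) / x, hy₁⟩ ∈ S := by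
    intro y hy hy₁
    rw [← hu] at hy
    obtain ⟨r, hr⟩ := Ideal.mem_span_range_iff_exists_fun.mp hy
    have hdec : (⟨(y : K) / x, hy₁⟩ : R₁) = ∑ j, (⟨(r j : K), hRR₁ (r j).2⟩ : R₁) * v j := by
      apply Subtype.ext
      change (y : K) / x = ((∑ j, (⟨(r j : K), hRR₁ (r j).2⟩ : R₁) * v j : R₁) : K)
      push_cast
      simp only [hv]
      rw [← hr]
      push_cast
      rw [Finset.sum_div]
      refine Finset.sum_congr rfl fun j _ => ?_
      ring
    rw [hdec]
    have : δ (∑ j, (⟨(r j : K), hRR₁ (r j).2⟩ : R₁) * v j) = ∑ j, δ ((⟨(r j : K), hRR₁ (r j).2⟩ : R₁) * v j) :=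
      map_sum (AddMonoidHom.mk' δ hδadd) _ _
    rw [this]
    refine Submodule.sum_mem _ fun j _ => ?_
    rw [hδmul]
    exact add_mem (Submodule.smul_mem _ _ (hvS j)) (Submodule.smul_mem _ _ (hold _ (r j).2))
  -- (b) the chart ring `R[P/x]` by closure induction
  have hchart : ∀ (y : K) (hy : y ∈ B), δ ⟨y, hBR₁ hy⟩ ∈ S := by
    intro y hy
    induction hy using Subring.closure_induction with
    | mem z hz =>
        rcases hz with hz | ⟨m, hm, rfl⟩
        · exact hold z hz
        · exact hquot m hm _
    | zero => rw [show (⟨0, _⟩ : R₁) = 0 from rfl, hδ0]; exact S.zero_mem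
    | one => rw [show (⟨1, _⟩ : R₁) = 1 from rfl, hδ1]; exact S.zero_mem
    | add z w hz hw hz' hw' =>
        have : (⟨z + w, hBR₁ (add_mem hz hw)⟩ : R₁) = ⟨z, hBR₁ hz⟩ + ⟨w, hBR₁ hw⟩ := rfl
        rw [this, hδadd]
        exact add_mem hz' hw'
    | neg z hz hz' =>
        have : (⟨-z, hBR₁ (neg_mem hz)⟩ : R₁) = ⟨z, hBR₁ hz⟩ := by
          apply Subtype.ext
          exact CharTwo.neg_eq z
        rw [this]
        exact hz'
    | mul z w hz hw hz' hw' =>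
        have : (⟨z * w, hBR₁ (mul_mem hz hw)⟩ : R₁) = ⟨z, hBR₁ hz⟩ * ⟨w, hBR₁ hw⟩ := rfl
        rw [this, hδmul]
        exact add_mem (Submodule.smul_mem _ _ hw') (Submodule.smul_mem _ _ hz')
  -- (c) fractions with unit denominators
  have hall : ∀ y : R₁, δ y ∈ S := by
    intro y
    have hy : (y : K) ∈ locAtCentre B O := by rw [← hR₁]; exact y.2
    obtain ⟨a, ha, b, hb, hvb, hab⟩ := mem_locAtCentre_iff.mp hy
    have hbK : b ≠ 0 := ne_zero_of_valuation_eq_one hvb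
    set a' : R₁ := ⟨a, hBR₁ ha⟩
    set b' : R₁ := ⟨b, hBR₁ hb⟩
    have hyb : y * b' = a' := by
      apply Subtype.ext
      change (y : K) * b = a
      rw [hab, div_mul_cancel₀ _ hbK]
    have hbinv : b⁻¹ ∈ R₁ := by
      rw [hR₁]; exact inv_mem_locAtCentre (le_locAtCentre _ O hb) hvb
    have hbu : IsUnit b' := (isUnit_subring_iff_inv_mem b').mpr ⟨hbK, hbinv⟩
    have hres : residue R₁ b' ≠ 0 := (hbu.map (residue R₁)).ne_zero
    have key : residue R₁ b' • δ y = δ a' - residue R₁ y • δ b' := by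
      rw [eq_sub_iff_add_eq, add_comm, ← hδmul, hyb]
    have : δ y = (residue R₁ b')⁻¹ • (residue R₁ b' • δ y) := by
      rw [smul_smul, inv_mul_cancel₀ hres, one_smul]
    rw [this, key]
    exact Submodule.smul_mem _ _ (sub_mem (hchart a ha) (Submodule.smul_mem _ _ (hchart b hb)))
  -- (d) `δ` restricted to `𝔫` is onto the cotangent space
  rw [eq_top_iff]
  rintro w -
  obtain ⟨m, rfl⟩ := (maximalIdeal R₁).toCotangent_surjective w
  rw [← hδmem m m.2]
  exact hall m

end Span

/-! ## §3 `δ` of an old element -/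

/-- **`δ` of an OLD element lies in the span of `δ x` and the `δ w_l`** when `𝔪_R = (u, w)` and the residues of
`R` are squares: `a = b² + m`, `m = Σ r_j u_j + Σ s_l w_l`, and `δ(u_j) = δ(x · (u_j/x)) = (u_j/x)‾ · δ x` since the
residue of `x ∈ 𝔫` vanishes. [folklore] -/
theorem delta_old_mem_span {R R₁ : Subring K} [IsLocalRing R] [IsLocalRing R₁] (hRR₁ : R ≤ R₁)
    (hperf : ∀ a : R, ∃ b : R, a - b ^ 2 ∈ maximalIdeal R)
    {h e : ℕ} (u : Fin h → R) (w : Fin e → R)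
    (huw : Ideal.span (Set.range u ∪ Set.range w) = maximalIdeal R)
    (hloc : ∀ m : R, m ∈ maximalIdeal R → residue R₁ ⟨(m : K), hRR₁ m.2⟩ = 0)
    (x' : R₁) (hx' : residue R₁ x' = 0) (v : Fin h → R₁) (hv : ∀ j, (⟨(u j : K), hRR₁ (u j).2⟩ : R₁) = x' * v j)
    (δ : R₁ → CotangentSpace R₁)
    (hδadd : ∀ a b : R₁, δ (a + b) = δ a + δ b)
    (hδmul : ∀ a b : R₁, δ (a * b) = residue R₁ a • δ b + residue R₁ b • δ a)
    (hδsq : ∀ b : R₁, δ (b ^ 2) = 0) (a : R) :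
    δ ⟨a, hRR₁ a.2⟩ ∈ Submodule.span (ResidueField R₁)
      (insert (δ x') (Set.range fun l => δ ⟨(w l : K), hRR₁ (w l).2⟩)) := by
  classical
  set S := Submodule.span (ResidueField R₁) (insert (δ x') (Set.range fun l => δ ⟨(w l : K), hRR₁ (w l).2⟩))
    with hS
  obtain ⟨b, hb⟩ := hperf a
  set m : R := a - b ^ 2 with hm
  -- coordinates of `m` in the generators `u, w` of `𝔪_R`
  rw [← huw, ← Set.Sum.elim_range, Ideal.mem_span_range_iff_exists_fun] at hb
  obtain ⟨c, hc⟩ := hb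
  rw [Fintype.sum_sum_type] at hc
  simp only [Sum.elim_inl, Sum.elim_inr] at hc
  -- `a = b² + Σ c_j u_j + Σ c_l w_l` in `R₁`
  let ι : R → R₁ := fun r => ⟨(r : K), hRR₁ r.2⟩
  have hιadd : ∀ r s : R, ι (r + s) = ι r + ι s := fun r s => rfl
  have hιmul : ∀ r s : R, ι (r * s) = ι r * ι s := fun r s => rfl
  have hdec : ι a = ι b ^ 2 + (∑ j, ι (c (Sum.inl j)) * (x' * v j) + ∑ l, ι (c (Sum.inr l)) * ι (w l)) := by
    have ha : a = b ^ 2 + (∑ j, c (Sum.inl j) * u j + ∑ l, c (Sum.inr l) * w l) := by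
      rw [hc, hm]; ring
    apply Subtype.ext
    change (a : K) = _
    rw [ha]
    push_cast
    congr 1
    congr 1
    refine Finset.sum_congr rfl fun j _ => ?_
    have := congrArg (fun r : R₁ => (r : K)) (hv j)
    simp only [Subring.coe_mul] at this
    change (c (Sum.inl j) : K) * (u j : K) = (c (Sum.inl j) : K) * ((x' : K) * (v j : K))
    rw [← this]
  have hδsum : ∀ (s : Finset (Fin h ⊕ Fin e)) (f : Fin h ⊕ Fin e → R₁), δ (∑ i ∈ s, f i) = ∑ i ∈ s, δ (f i) :=
    fun s f => map_sum (AddMonoidHom.mk' δ hδadd) _ _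
  have hsum1 : δ (∑ j, ι (c (Sum.inl j)) * (x' * v j)) ∈ S := by
    have : δ (∑ j, ι (c (Sum.inl j)) * (x' * v j)) = ∑ j, δ (ι (c (Sum.inl j)) * (x' * v j)) :=
      map_sum (AddMonoidHom.mk' δ hδadd) _ _
    rw [this]
    refine Submodule.sum_mem _ fun j _ => ?_
    have hx0' : residue R₁ (x' * v j) = 0 := by rw [map_mul, hx', zero_mul]
    rw [hδmul, hδmul x' (v j), hx', zero_smul, zero_add, hx0', zero_smul, add_zero]
    exact Submodule.smul_mem _ _ (Submodule.smul_mem _ _ (Submodule.subset_span (Set.mem_insert _ _)))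
  have hsum2 : δ (∑ l, ι (c (Sum.inr l)) * ι (w l)) ∈ S := by
    have : δ (∑ l, ι (c (Sum.inr l)) * ι (w l)) = ∑ l, δ (ι (c (Sum.inr l)) * ι (w l)) :=
      map_sum (AddMonoidHom.mk' δ hδadd) _ _
    rw [this]
    refine Submodule.sum_mem _ fun l _ => ?_
    rw [hδmul]
    refine add_mem (Submodule.smul_mem _ _ (Submodule.subset_span (Set.mem_insert_of_mem _ ⟨l, rfl⟩))) ?_
    -- `δ` of the coefficient, an old element: recurse? No — its residue-weighted contribution is absorbed:
    -- we only need `residue (w l) • δ (c l)`, and `w l ∈ 𝔪_R ⊆ 𝔫` has residue zero.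
    have hwl : residue R₁ (ι (w l)) = 0 :=
      hloc (w l) (huw ▸ Ideal.subset_span (Or.inr ⟨l, rfl⟩))
    rw [hwl, zero_smul]
    exact S.zero_mem
  show δ (ι a) ∈ S
  rw [hdec, hδadd, hδadd, hδsq, zero_add]
  exact add_mem hsum1 hsum2

end Summit.ResolutionOfSingularities.ResolutionOfSingularities.Theorems.SwitchingDichotomy.LowOrderChart

end
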